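import Mathlib
import Summits.NavierStokesRegularity.NavierStokesRegularity.Theses.SymmetryModuliCount
import Summits.NavierStokesRegularity.NavierStokesRegularity.Theorems.SymmetryModuliCountStretchingCertificateComparisonWeighted
import Summits.NavierStokesRegularity.NavierStokesRegularity.Theorems.SymmetryModuliCountStretchingCertificateComparisonMaxPrinciple
import Summits.NavierStokesRegularity.NavierStokesRegularity.Theorems.SqueezeCycleExtremalBiaxialitySubcriticalGaugeStrainBound
import Literature.Analysis.FluidPDE.CurlFreeLiouville
import HarnessLib

/-!
# Route SymmetryModuliCount — the stretching-certificate comparison theorem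

Theorems file closing the support item stmt-NavierStokesRegularity-14340
(`Summit.NavierStokesRegularity.NavierStokesRegularity.Theses.SymmetryModuliCount.StretchingCertificateComparison`,
the "lever C engine" of the route): **an element of the Type-I ancient mild class `A_C`
(`IsTypeIAncientMild C u`) that admits a stretching certificate vanishes identically.**

A stretching certificate is `(δ, A, h)` with `δ > 0`, `h : (−∞,0) × ℝ³ → [1, ∞)` jointly smooth,
`‖∇h‖ ≤ A(1/√(−t) + |x|/(−t)) h`, and, wherever `ω = curl u ≠ 0`,
`((−t)(⟪∇u ξ, ξ⟫ − |∇ξ|²_F) − 1 + δ) h ≤ (−t)(∂ₜh + u·∇h − Δh)` (`ξ = ω/|ω|`).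

## Proof

Physical variables throughout (no similarity variables, no compactness, no strong maximum
principle). Put `F = |ω|²/h²` and `P = (−t)^{2−2δ} F`.

* **Kato + certificate** (tree: `stretchCert_F_subsolution`, Constantin 1990 (2.9) /
  Constantin–Fefferman 1993 §1 written for the square so that no regularisation at `{ω = 0}` is
  needed): at a point with `ω ≠ 0`, `∂ₜF + u·∇F − ΔF ≤ 2(1−δ)F/(−t) + 2h⁻¹∇F·∇h`; the weight
  `(−t)^{2−2δ}` absorbs the zeroth-order term exactly, so
  `∂ₜP + u·∇P − ΔP ≤ 2h⁻¹ ∇P·∇h` (`stretchCert_P_pointwise_of_ne`).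
* At a zero of `ω` the nonnegative smooth `P` has a space–time minimum: `∇P = 0`, `∂ₜP = 0`,
  `ΔP ≥ 0`. Hence everywhere on `t < 0`:
  `∂ₜP ≤ ΔP + (C/√(−t) + 6|A|(1/√(−t) + |x|/(−t))) ‖∇P‖` (`stretchCert_P_subsolution`), a
  drift–heat inequality with linearly growing drift (`|u| ≤ C/√(−t)`).
* **Type-I bound**: `(−t)‖∇u‖ ≤ K₀(C)` (tree: `exists_gauge_norm_fderiv_le_of_typeI`, KNSS 2009
  Prop. 4.1 by zoom invariance) and `|ω| ≤ ‖curl‖‖∇u‖` give `P ≤ (κK₀)²(−t)^{−2δ}`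
  (`stretchCert_P_le`).
* **Weak maximum principle** on `[T₁, t] × ℝ³` (tree: `le_of_subsolution_linear_drift`,
  Lieberman 1996 Ch. II with the quadratic barrier): `P(t, x) ≤ sup P(T₁, ·) ≤ (κK₀)²(−T₁)^{−2δ}`,
  and `T₁ → −∞` (this is where ANCIENT enters) gives `P(t, x) ≤ 0`, i.e. `ω(t, x) = 0`
  (`stretchCert_curl_eq_zero`).
* `curl u(t) = 0`, `div u(t) = 0`, `|u(t)| ≤ C/√(−t)` ⇒ `u(t, ·)` constant (tree:
  `eq_of_curl_eq_zero_of_isDivFree_of_bounded`, KNSS 2009 Lemma 3.1) ⇒ `u ≡ 0` in the KNSS gauge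
  (tree: `IsTypeIAncientMild.eq_zero_of_slice_const`, KNSS 2009 Rem. 6.1).

## References

* P. Constantin, Comm. Math. Phys. 129 (1990) 241–266, (2.9). [Constantin1990]
* P. Constantin, C. Fefferman, Indiana Univ. Math. J. 42 (1993) 775–789, §1. [ConstantinFefferman1993]
* G. M. Lieberman, *Second order parabolic differential equations* (1996), Ch. II Lemma 2.1–2.3,
  Thm. 2.4. [Lieberman1996]
* G. Koch, N. Nadirashvili, G. Seregin, V. Šverák, Acta Math. 203 (2009) 83–105, Prop. 4.1,
  Lemma 3.1, Rem. 6.1. [KochNadirashviliSereginSverak2009]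
-/

noncomputable section

-- the summit and its single sub-problem share the name (CONVENTIONS §1), as in every Theorems file
set_option linter.dupNamespace false

open Set Function Filter
open scoped RealInnerProductSpace Laplacian ContDiff Topology

namespace Summit.NavierStokesRegularity.NavierStokesRegularity.Theorems

open Literature.Analysis Literature.Analysis.FluidPDE

/-- **The vorticity of a certified Type-I ancient mild field vanishes.** For `u ∈ A_C` with a
stretching certificate `(δ, A, h)`, `curl u ≡ 0` on `t < 0`: the weighted quotient
`P = (−t)^{2−2δ}|ω|²/h²` is a jointly smooth subsolution of a drift–heat inequality with linearly
growing drift (`stretchCert_P_subsolution`), bounded by `(κK₀)²(−t)^{−2δ}` (`stretchCert_P_le`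
with the class-uniform gauge gradient bound `exists_gauge_norm_fderiv_le_of_typeI`); the weak
maximum principle on `[T₁, t] × ℝ³` (`le_of_subsolution_linear_drift`) gives
`P(t, x) ≤ (κK₀)²(−T₁)^{−2δ} → 0` as `T₁ → −∞`. [cite: Lieberman1996, Ch. II Lemma 2.1 and Thm. 2.4] -/
theorem stretchCert_curl_eq_zero
    {C : ℝ} {u : ℝ → EuclideanSpace ℝ (Fin 3) → EuclideanSpace ℝ (Fin 3)}
    (hu : IsTypeIAncientMild C u) {h : ℝ → EuclideanSpace ℝ (Fin 3) → ℝ}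
    (hh : IsSmoothSpaceTimeOn (Iio 0) h) (hh1 : ∀ t < 0, ∀ y, 1 ≤ h t y) {δ A : ℝ} (hδ : 0 < δ)
    (hgrad : ∀ t < 0, ∀ y, ‖fderiv ℝ (h t) y‖ ≤ A * (1 / Real.sqrt (-t) + ‖y‖ / (-t)) * h t y)
    (hcert : ∀ t < 0, ∀ y, curl (u t) y ≠ 0 →
      ((-t) * (⟪fderiv ℝ (u t) y (vorticityDirection (curl (u t)) y),
          vorticityDirection (curl (u t)) y⟫
          - frobeniusNormSq (fderiv ℝ (vorticityDirection (curl (u t))) y)) - 1 + δ) * h t y ≤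
        (-t) * (timeDeriv h t y + fderiv ℝ (h t) y (u t y) - (Δ (h t)) y))
    {t : ℝ} (ht : t < 0) (x : EuclideanSpace ℝ (Fin 3)) : curl (u t) x = 0 := by
  have hsm : IsSmoothSpaceTimeOn (Iio 0) u := hu.contDiffOn
  have ht0 : 0 < -t := neg_pos.2 ht
  obtain ⟨K₀, hK₀⟩ := exists_gauge_norm_fderiv_le_of_typeI C
  have hK₀u : ∀ s < 0, ∀ y, (-s) * ‖fderiv ℝ (u s) y‖ ≤ K₀ := hK₀ hu
  set γ : ℝ := 2 - 2 * δ with hγ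
  set P : ℝ → EuclideanSpace ℝ (Fin 3) → ℝ :=
    fun s y => (-s) ^ γ * (‖curl (u s) y‖ ^ 2 / h s y ^ 2) with hPdef
  set L : ℝ := (‖curlCLM‖ * K₀) ^ 2 with hL
  have hL0 : 0 ≤ L := sq_nonneg _
  have hPsm : IsSmoothSpaceTimeOn (Iio 0) P := isSmoothSpaceTimeOn_stretchCert_P hsm hh hh1 γ
  have hPle : ∀ s < (0 : ℝ), ∀ y, P s y ≤ L * (-s) ^ (-(2 * δ)) := fun s hs y =>
    stretchCert_P_le hK₀u hh1 δ hs y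
  -- the weak maximum principle on `[T₁, t] × ℝ³`
  have hC0 : 0 ≤ C := hu.nonneg
  set K : ℝ := (C + 6 * |A|) / Real.sqrt (-t) + 6 * |A| / (-t) with hK
  have hK0 : 0 ≤ K := by positivity
  have hmp : ∀ T₁ < t, P t x ≤ L * (-T₁) ^ (-(2 * δ)) := by
    intro T₁ hT₁
    have hIcc : Icc T₁ t ⊆ Iio 0 := fun s hs => lt_of_le_of_lt hs.2 ht
    refine le_of_subsolution_linear_drift (T₁ := T₁) (T₂ := t) (B := L * (-t) ^ (-(2 * δ))) hK0
      (P := P) (Pₜ := fun s y => deriv (fun r => P r y) s) ?_ ?_ ?_ ?_ ?_ ?_ t ⟨hT₁.le, le_rfl⟩ x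
    · exact hPsm.continuousOn.mono (prod_mono hIcc Subset.rfl)
    · intro s hs
      exact (hPsm.contDiff_slice (hIcc ⟨hs.1.le, hs.2⟩)).of_le (by norm_cast)
    · intro s hs y
      exact hPsm.hasDerivAt_timeLine isOpen_Iio (hIcc ⟨hs.1.le, hs.2⟩) y
    · intro s hs y
      have hs0 : s < 0 := lt_of_le_of_lt hs.2 ht
      have hms : 0 < -s := neg_pos.2 hs0
      have key := stretchCert_P_subsolution hu hh hh1 (δ := δ) (A := A) hgrad hcert hs0 y
      have hcoef : C / Real.sqrt (-s) + 6 * |A| * (1 / Real.sqrt (-s) + ‖y‖ / (-s)) ≤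
          K * (1 + ‖y‖) := by
        have hst : -t ≤ -s := by linarith [hs.2]
        have hsq : Real.sqrt (-t) ≤ Real.sqrt (-s) := Real.sqrt_le_sqrt hst
        have hsqt : 0 < Real.sqrt (-t) := Real.sqrt_pos.2 ht0
        have i1 : C / Real.sqrt (-s) ≤ C / Real.sqrt (-t) :=
          div_le_div_of_nonneg_left hC0 hsqt hsq
        have i2 : 1 / Real.sqrt (-s) ≤ 1 / Real.sqrt (-t) :=
          div_le_div_of_nonneg_left zero_le_one hsqt hsq
        have i3 : ‖y‖ / (-s) ≤ ‖y‖ / (-t) := div_le_div_of_nonneg_left (norm_nonneg _) ht0 hst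
        have hA0 : 0 ≤ |A| := abs_nonneg A
        have j1 : (C + 6 * |A|) / Real.sqrt (-t) ≤ K := by
          have : 0 ≤ 6 * |A| / (-t) := by positivity
          rw [hK]; linarith
        have j2 : 6 * |A| / (-t) ≤ K := by
          have : 0 ≤ (C + 6 * |A|) / Real.sqrt (-t) := by positivity
          rw [hK]; linarith
        have hy0 := norm_nonneg y
        calc C / Real.sqrt (-s) + 6 * |A| * (1 / Real.sqrt (-s) + ‖y‖ / (-s))
            ≤ C / Real.sqrt (-t) + 6 * |A| * (1 / Real.sqrt (-t) + ‖y‖ / (-t)) := by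
              nlinarith
          _ = (C + 6 * |A|) / Real.sqrt (-t) + (6 * |A| / (-t)) * ‖y‖ := by ring
          _ ≤ K + K * ‖y‖ := by nlinarith
          _ = K * (1 + ‖y‖) := by ring
      have hmul := mul_le_mul_of_nonneg_right hcoef (norm_nonneg (fderiv ℝ (P s) y))
      change deriv (fun r => P r y) s ≤ (Δ (P s)) y
        + (C / Real.sqrt (-s) + 6 * |A| * (1 / Real.sqrt (-s) + ‖y‖ / (-s)))
          * ‖fderiv ℝ (P s) y‖ at key
      show deriv (fun r => P r y) s ≤ (Δ (P s)) y + K * (1 + ‖y‖) * ‖fderiv ℝ (P s) y‖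
      linarith
    · intro s hs y
      have hs0 : s < 0 := lt_of_le_of_lt hs.2 ht
      refine (hPle s hs0 y).trans ?_
      have hmon : (-s) ^ (-(2 * δ)) ≤ (-t) ^ (-(2 * δ)) :=
        Real.rpow_le_rpow_of_nonpos ht0 (by linarith [hs.2]) (by linarith)
      exact mul_le_mul_of_nonneg_left hmon hL0
    · intro y
      exact hPle T₁ (hT₁.trans ht) y
  -- `T₁ → −∞`
  have hlim : Tendsto (fun R : ℝ => L * R ^ (-(2 * δ))) atTop (𝓝 0) := by
    have := (tendsto_rpow_neg_atTop (by linarith : 0 < 2 * δ)).const_mul L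
    simpa using this
  have hP0 : P t x ≤ 0 := by
    refine ge_of_tendsto hlim ?_
    filter_upwards [eventually_gt_atTop (-t)] with R hR
    have := hmp (-R) (by linarith)
    simpa using this
  -- conclude
  have hw : 0 < (-t) ^ γ := Real.rpow_pos_of_pos ht0 γ
  have hhx : 0 < h t x := lt_of_lt_of_le one_pos (hh1 t ht x)
  have hPtx : P t x = (-t) ^ γ * (‖curl (u t) x‖ ^ 2 / h t x ^ 2) := rfl
  have hq : ‖curl (u t) x‖ ^ 2 / h t x ^ 2 ≤ 0 := by
    refine not_lt.1 fun hcon => ?_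
    have := mul_pos hw hcon
    linarith
  have hq' : ‖curl (u t) x‖ ^ 2 ≤ 0 := by
    have := (div_le_iff₀ (by positivity : (0 : ℝ) < h t x ^ 2)).1 hq
    simpa using this
  have hn : ‖curl (u t) x‖ = 0 := by nlinarith [norm_nonneg (curl (u t) x)]
  exact norm_eq_zero.1 hn

/-- **Certificate comparison (route `SymmetryModuliCount`, item stmt-NavierStokesRegularity-14340):
an element of `A_C` that admits a stretching certificate vanishes identically.** The vorticity
vanishes (`stretchCert_curl_eq_zero`); a bounded `C²` field with `curl = 0`, `div = 0` is constant
on each slice (`eq_of_curl_eq_zero_of_isDivFree_of_bounded`, KNSS 2009 Lemma 3.1), and the KNSS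
gauge kills slice-constant elements of the class (`IsTypeIAncientMild.eq_zero_of_slice_const`,
KNSS 2009 Rem. 6.1). [cite: KochNadirashviliSereginSverak2009, Lemma 3.1 and Remark 6.1 (arXiv:0709.3599)] -/
theorem symmetryModuliCount_stretchingCertificateComparison_proof :
    Summit.NavierStokesRegularity.NavierStokesRegularity.Theses.SymmetryModuliCount.StretchingCertificateComparison := by
  unfold Summit.NavierStokesRegularity.NavierStokesRegularity.Theses.SymmetryModuliCount.StretchingCertificateComparison
  intro C u hu hex t ht x
  obtain ⟨δ, A, h, hδ, hh, hh1g, hcert⟩ := hex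
  have hh' : IsSmoothSpaceTimeOn (Iio 0) h := hh
  have hh1 : ∀ s < 0, ∀ y, 1 ≤ h s y := fun s hs y => (hh1g s hs y).1
  have hgrad : ∀ s < 0, ∀ y, ‖fderiv ℝ (h s) y‖ ≤ A * (1 / Real.sqrt (-s) + ‖y‖ / (-s)) * h s y :=
    fun s hs y => (hh1g s hs y).2
  have hω : ∀ s < 0, ∀ y, curl (u s) y = 0 := fun s hs y =>
    stretchCert_curl_eq_zero hu hh' hh1 hδ hgrad hcert hs y
  have hub : ∀ s < 0, ∀ y, u s y = u s 0 := fun s hs y =>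
    eq_of_curl_eq_zero_of_isDivFree_of_bounded ((hu.contDiff_slice hs).of_le (by norm_cast))
      (hω s hs) (hu.isDivFree hs) (fun z => hu.norm_le hs z) y 0
  exact hu.eq_zero_of_slice_const hub ht x

end Summit.NavierStokesRegularity.NavierStokesRegularity.Theorems

end
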